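import Mathlib
import HarnessLib

/-!
# Crux `NoZenoR` / `NoZeno` (stmt-ResolutionOfSingularities-19943 / -16483), β2 descent, `stub_L1wCore` (F1) route,
# BC-2 algebra: over a base in which the subfield is SEPARABLY CLOSED, separable minimal polynomials do not change

OURS (cell res-hironaka, chain W4.4; stub worker res-L0-w44-stub-2 g11; plan `L1W-PREP.md` 4a61d05beab993ff §3.1
BC-2 (a)/(b), first algebraic brick: «the component `η_j` of `E_η ⊗_κ κ_B` has function field `κ(η) ⊗_(L_η) L_j`, a
FIELD» ⇐ THIS FILE: a separable irreducible polynomial over `L` stays irreducible over any extension `F` of `L` in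
which `L` is separably closed).  Pure field theory over Mathlib; nothing here is a statement of the manuscript under
review; AI-written, weaker than expert review.

For a tower `K / E / F` of fields with `separableClosure F E = ⊥` («`F` is separably closed in `E`»; e.g.
`E := κ(η)` the function field of an integral exceptional curve and `F := L_η = κ^sep ∩ κ(η)`, by Mathlib's
`separableClosure.separableClosure_eq_bot`):

* `minpoly_map_eq_of_separableClosure_eq_bot` — an element `x ∈ K` SEPARABLE over `F` has the same minimal
  polynomial over `F` and over `E` (the coefficients of `minpoly E x` are symmetric functions of roots of
  `minpoly F x`, hence separable algebraic over `F`, hence in `F`).  Mathlib has the purely-inseparable-tower case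
  (`minpoly.map_eq_of_isSeparable_of_isPurelyInseparable`); here `E / F` is arbitrary (typically transcendental).
* `natDegree_minpoly_eq_of_separableClosure_eq_bot`, `finrank_adjoin_simple_eq_of_separableClosure_eq_bot` —
  hence `[E(x) : E] = [F(x) : F]`: `E` and `F(x)` are linearly disjoint over `F`;
* `Polynomial.Separable.map_irreducible_of_separableClosure_eq_bot` — a separable irreducible `f ∈ F[X]` stays
  irreducible over `E` (cf. EGA IV₂ (4.3.2)–(4.3.5): `E/F` primary ⇒ `E ⊗_F F′` irreducible; with `F′/F` separable
  it is then a field).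
-/

noncomputable section

-- single-problem summit: the doubled namespace component `ResolutionOfSingularities` is forced
set_option linter.dupNamespace false

namespace Summit.ResolutionOfSingularities.ResolutionOfSingularities.Theorems.NoZeno.ExcCount

open Polynomial IntermediateField

variable {F E K : Type*} [Field F] [Field E] [Field K] [Algebra F E] [Algebra E K] [Algebra F K]
  [IsScalarTower F E K]

/-- **Separable minimal polynomials do not change over a base in which `F` is separably closed**: if
`separableClosure F E = ⊥` and `x ∈ K` is separable over `F`, then `(minpoly F x).map (algebraMap F E) = minpoly E x`.
[this work] -/
theorem minpoly_map_eq_of_separableClosure_eq_bot (h : separableClosure F E = ⊥) {x : K}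
    (hsep : IsSeparable F x) : (minpoly F x).map (algebraMap F E) = minpoly E x := by
  have hi : IsIntegral F x := hsep.isIntegral
  have hi' : IsIntegral E x := hi.tower_top
  -- work in an algebraic closure `Ω` of `K`
  let Ω := AlgebraicClosure K
  set p : E[X] := minpoly E x with hp
  have hpmonic : p.Monic := minpoly.monic hi'
  have hpdvd : p ∣ (minpoly F x).map (algebraMap F E) := minpoly.dvd_map_of_isScalarTower F E x
  -- every root of `p` in `Ω` is separable over `F`
  have hroot : ∀ a ∈ (p.map (algebraMap E Ω)).roots, IsSeparable F a := by
    intro a ha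
    have hpa : aeval a p = 0 := by
      rw [mem_roots (Polynomial.map_ne_zero hpmonic.ne_zero), IsRoot.def, eval_map, ← aeval_def] at ha
      exact ha
    have hma : aeval a (minpoly F x) = 0 := by
      obtain ⟨r, hr⟩ := hpdvd
      have : aeval a ((minpoly F x).map (algebraMap F E)) = 0 := by
        rw [hr, map_mul, hpa, zero_mul]
      rwa [aeval_map_algebraMap] at this
    have hia : IsIntegral F a := by
      refine ⟨minpoly F x, minpoly.monic hi, ?_⟩
      rwa [← aeval_def]
    exact (hsep.of_dvd (minpoly.dvd F a hma) : IsSeparable F a)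
  -- hence the coefficients of `p` (read in `Ω`) are separable over `F`
  let M : IntermediateField F Ω := separableClosure F Ω
  have hsplit : (p.map (algebraMap E Ω)).Splits := IsAlgClosed.splits _
  have hlift : p.map (algebraMap E Ω) ∈ Polynomial.lifts (algebraMap M Ω) := by
    refine hsplit.mem_lift_of_roots_mem_range (hpmonic.map _) (algebraMap M Ω) fun a ha => ?_
    exact ⟨⟨a, mem_separableClosure_iff.mpr (hroot a ha)⟩, rfl⟩
  have hcoeffΩ : ∀ n, IsSeparable F ((p.map (algebraMap E Ω)).coeff n) := by
    intro n
    obtain ⟨c, hc⟩ := (lifts_iff_coeff_lifts _).mp hlift n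
    rw [← hc]
    change IsSeparable F (c : Ω)
    exact mem_separableClosure_iff.mp c.2
  -- so the coefficients of `p` lie in `separableClosure F E = ⊥`, i.e. come from `F`
  have hcoeff : ∀ n, p.coeff n ∈ (algebraMap F E).range := by
    intro n
    have hs : IsSeparable F (p.coeff n) := by
      have h1 := hcoeffΩ n
      rw [coeff_map] at h1
      unfold IsSeparable at h1 ⊢
      rwa [minpoly.algebraMap_eq (algebraMap E Ω).injective] at h1
    have hmem : p.coeff n ∈ separableClosure F E := mem_separableClosure_iff.mpr hs
    rw [h, IntermediateField.mem_bot] at hmem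
    obtain ⟨c, hc⟩ := hmem
    exact ⟨c, hc⟩
  have hplifts : p ∈ Polynomial.lifts (algebraMap F E) := (lifts_iff_coeff_lifts _).mpr fun n => hcoeff n
  obtain ⟨p₁, hp₁, hdeg, hp₁monic⟩ := lifts_and_natDegree_eq_and_monic hplifts hpmonic
  -- `p₁ ∈ F[X]` is monic with root `x`, so `minpoly F x ∣ p₁` and the degrees force equality
  have hp₁x : aeval x p₁ = 0 := by
    rw [← aeval_map_algebraMap E, hp₁]
    exact minpoly.aeval E x
  have hle : ((minpoly F x).map (algebraMap F E)).natDegree ≤ p.natDegree := by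
    rw [natDegree_map, ← hdeg]
    have := minpoly.min F x hp₁monic hp₁x
    exact natDegree_le_natDegree this
  exact eq_of_monic_of_dvd_of_natDegree_le hpmonic ((minpoly.monic hi).map _) hpdvd hle

/-- Degree form: `natDegree (minpoly E x) = natDegree (minpoly F x)`. [this work] -/
theorem natDegree_minpoly_eq_of_separableClosure_eq_bot (h : separableClosure F E = ⊥) {x : K}
    (hsep : IsSeparable F x) : (minpoly E x).natDegree = (minpoly F x).natDegree := by
  rw [← minpoly_map_eq_of_separableClosure_eq_bot h hsep, natDegree_map]

/-- **Linear disjointness, simple case**: `[E(x) : E] = [F(x) : F]` for `x` separable over `F` when `F` is separably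
closed in `E`. [this work] -/
theorem finrank_adjoin_simple_eq_of_separableClosure_eq_bot (h : separableClosure F E = ⊥) {x : K}
    (hsep : IsSeparable F x) : Module.finrank E E⟮x⟯ = Module.finrank F F⟮x⟯ := by
  rw [adjoin.finrank hsep.isIntegral.tower_top, adjoin.finrank hsep.isIntegral,
    natDegree_minpoly_eq_of_separableClosure_eq_bot h hsep]

/-- **A separable irreducible polynomial stays irreducible over an extension in which the ground field is separably
closed** (the `IsPurelyInseparable` hypothesis of Mathlib's `Polynomial.Separable.map_irreducible_of_isPurelyInseparable`
replaced by `separableClosure F E = ⊥`, which allows transcendental `E/F`). [this work] -/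
theorem _root_.Polynomial.Separable.map_irreducible_of_separableClosure_eq_bot
    (h : separableClosure F E = ⊥) {f : F[X]} (hsep : f.Separable) (hirr : Irreducible f) :
    Irreducible (f.map (algebraMap F E)) := by
  let K' := AlgebraicClosure E
  obtain ⟨x, hx⟩ := IsAlgClosed.exists_aeval_eq_zero K' f
    (natDegree_pos_iff_degree_pos.1 hirr.natDegree_pos).ne'
  have ha : Associated f (minpoly F x) := by
    have := isUnit_C.2 (leadingCoeff_ne_zero.2 hirr.ne_zero).isUnit.inv
    exact ⟨this.unit, by rw [IsUnit.unit_spec, minpoly.eq_of_irreducible hirr hx]⟩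
  have ha' : Associated (f.map (algebraMap F E)) ((minpoly F x).map (algebraMap F E)) :=
    ha.map (mapRingHom (algebraMap F E)).toMonoidHom
  have heq := minpoly_map_eq_of_separableClosure_eq_bot (K := K') h (x := x) (ha.separable hsep)
  rw [ha'.irreducible_iff, heq]
  exact minpoly.irreducible (Algebra.IsIntegral.isIntegral x)

end Summit.ResolutionOfSingularities.ResolutionOfSingularities.Theorems.NoZeno.ExcCount

end
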